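import Summits.Ventures.PercRepro.ProfilePointedColoop

/-!
# PercRepro — THE ARITHMETIC HALF OF «(Ĉ) IS CLOSED UNDER DIRECT SUMS», AS A STATEMENT (p10, gen 22;
`proofs/P10-COLOOPEXT-g22.md` §7, (7.9))

The paper theorem of §7 says: if `P`, `c`, `a` are the bi-independent profile of `M₁`, the extension counts `c^p(M₁)`
(= the profile of `M₁ / p`) and the profile of `M₂`, then the convolutions `a ∗ P`, `a ∗ c` — the profile and the extension
counts of `M₁ ⊕ M₂` (ProfilePointedDirectSum) — satisfy (Ĉ) at every level whenever `(P, c)` does.  Its ARITHMETIC HALF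
is a statement about three zero-extended sequences `ℤ → ℚ` alone (symmetric, Theorem A, `c 0 = P 0`, the (Ĉ)-defects of
`(P, c)` non-negative on the window), and THIS FILE states it as the `Prop` `SeqPointedConv` (NOT asserted; proof on paper:
the exact identity (7.2), the fold, the monotone-pair lemma (7.4), one covering term per regime (7.5)/(7.8); every step
numerically verified).  Nothing here is proved beyond well-formedness; nothing asserts (Ĉ).
-/

namespace PercRepro.Cogirth

open Finset

/-- **THE ARITHMETIC HALF OF THE DIRECT-SUM THEOREM (NOT asserted)**: for zero-extended sequences `P` on `[0, N₁]`,
`c` on `[0, N₁ − 1]`, `a` on `[0, N₂]` — each symmetric, non-negative and Theorem-A (`(L − i)·f_i ≤ (i + 1)·f_{i+1}` below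
the middle of its range) — with `c 0 = P 0` and the (Ĉ)-defects `i·P_{i+1} + (N₁ − 2i − 1)·c_i − (N₁ − i − 1)·P_i` of
`(P, c)` non-negative for `2i + 2 ≤ N₁`, the convolutions `(a ∗ P)_k = Σ_j a_j P_{k−j}`, `(a ∗ c)_k = Σ_j a_j c_{k−j}` satisfy
(Ĉ) on `N₁ + N₂` elements at every level `2k + 2 ≤ N₁ + N₂`. -/
def SeqPointedConv : Prop :=
  ∀ (N₁ N₂ : ℕ) (P c a : ℤ → ℚ),
    (∀ i, i < 0 → P i = 0) → (∀ i, (N₁ : ℤ) < i → P i = 0) → (∀ i, P ((N₁ : ℤ) - i) = P i) →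
    (∀ i, 0 ≤ P i) →
    (∀ i : ℤ, 0 ≤ i → 2 * i + 2 ≤ N₁ → ((N₁ : ℚ) - i) * P i ≤ (i + 1) * P (i + 1)) →
    (∀ i, i < 0 → c i = 0) → (∀ i, (N₁ : ℤ) - 1 < i → c i = 0) → (∀ i, c ((N₁ : ℤ) - 1 - i) = c i) →
    (∀ i, 0 ≤ c i) →
    (∀ i : ℤ, 0 ≤ i → 2 * i + 2 ≤ (N₁ : ℤ) - 1 → ((N₁ : ℚ) - 1 - i) * c i ≤ (i + 1) * c (i + 1)) →
    c 0 = P 0 →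
    (∀ i : ℤ, 0 ≤ i → 2 * i + 2 ≤ N₁ →
      ((N₁ : ℚ) - i - 1) * P i ≤ i * P (i + 1) + ((N₁ : ℚ) - 2 * i - 1) * c i) →
    (∀ j, j < 0 → a j = 0) → (∀ j, (N₂ : ℤ) < j → a j = 0) → (∀ j, a ((N₂ : ℤ) - j) = a j) →
    (∀ j, 0 ≤ a j) →
    (∀ j : ℤ, 0 ≤ j → 2 * j + 2 ≤ N₂ → ((N₂ : ℚ) - j) * a j ≤ (j + 1) * a (j + 1)) →
    ∀ k : ℤ, 0 ≤ k → 2 * k + 2 ≤ N₁ + N₂ →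
      ((N₁ + N₂ : ℚ) - k - 1) * (∑ j ∈ Finset.Icc (0 : ℤ) N₂, a j * P (k - j)) ≤
        k * (∑ j ∈ Finset.Icc (0 : ℤ) N₂, a j * P (k + 1 - j)) +
          ((N₁ + N₂ : ℚ) - 2 * k - 1) * (∑ j ∈ Finset.Icc (0 : ℤ) N₂, a j * c (k - j))

/-! ### The monotone-pair lemma (7.4), the first brick of the proof: the Theorem-A chain -/

/-- **THE THEOREM-A CHAIN**: for a sequence `f` with `(L − j)·f_j ≤ (j + 1)·f_{j+1}` for `2j + 2 ≤ L`, and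
`y ≤ x` with `2x ≤ L`: `C(L, x)·f_y ≤ C(L, y)·f_x` (the density `f_j / C(L, j)` is non-decreasing up to the middle). -/
theorem chain_choose_mul_le {L : ℕ} {f : ℕ → ℚ} (hf : ∀ j, 2 * j + 2 ≤ L → ((L : ℚ) - j) * f j ≤ (j + 1) * f (j + 1))
    (y : ℕ) :
    ∀ d : ℕ, 2 * (y + d) ≤ L → (Nat.choose L (y + d) : ℚ) * f y ≤ (Nat.choose L y : ℚ) * f (y + d) := by
  intro d
  induction d with
  | zero => intro _; simp
  | succ d ih =>
    intro hd
    have ih' := ih (by omega)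
    have hA := hf (y + d) (by omega)
    -- `(y + d + 1) · C(L, y + d + 1) = (L − (y + d)) · C(L, y + d)`
    have hc : ((y + d + 1 : ℕ) : ℚ) * (Nat.choose L (y + d + 1) : ℚ) =
        ((L - (y + d) : ℕ) : ℚ) * (Nat.choose L (y + d) : ℚ) := by
      have := Nat.choose_succ_right_eq L (y + d)
      exact_mod_cast (by rw [mul_comm] at this; rw [mul_comm (Nat.choose L (y + d))] at this; exact this)
    have hLd : ((L - (y + d) : ℕ) : ℚ) = (L : ℚ) - ((y + d : ℕ) : ℚ) := by
      rw [Nat.cast_sub (by omega)]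
    rw [hLd] at hc
    have hpos : (0 : ℚ) < ((y + d + 1 : ℕ) : ℚ) := by positivity
    -- multiply the chain step by `C(L, y + d) / (y + d + 1)`
    rw [show y + (d + 1) = y + d + 1 by omega]
    have key : ((y + d + 1 : ℕ) : ℚ) * ((Nat.choose L (y + d + 1) : ℚ) * f y) ≤
        ((y + d + 1 : ℕ) : ℚ) * ((Nat.choose L y : ℚ) * f (y + d + 1)) := by
      calc ((y + d + 1 : ℕ) : ℚ) * ((Nat.choose L (y + d + 1) : ℚ) * f y)
          = (((L : ℚ) - ((y + d : ℕ) : ℚ)) * (Nat.choose L (y + d) : ℚ)) * f y := by rw [← hc]; ring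
        _ = ((L : ℚ) - ((y + d : ℕ) : ℚ)) * ((Nat.choose L (y + d) : ℚ) * f y) := by ring
        _ ≤ ((L : ℚ) - ((y + d : ℕ) : ℚ)) * ((Nat.choose L y : ℚ) * f (y + d)) := by
            apply mul_le_mul_of_nonneg_left ih'
            have : ((y + d : ℕ) : ℚ) ≤ (L : ℚ) := by exact_mod_cast (by omega : y + d ≤ L)
            linarith
        _ = (Nat.choose L y : ℚ) * (((L : ℚ) - ((y + d : ℕ) : ℚ)) * f (y + d)) := by ring
        _ ≤ (Nat.choose L y : ℚ) * ((((y + d : ℕ) : ℚ) + 1) * f (y + d + 1)) := by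
            apply mul_le_mul_of_nonneg_left _ (by positivity)
            have h := hA
            push_cast at h ⊢
            linarith
        _ = ((y + d + 1 : ℕ) : ℚ) * ((Nat.choose L y : ℚ) * f (y + d + 1)) := by push_cast; ring
    exact le_of_mul_le_mul_left key hpos

/-- The chain from `0`: `C(L, x)·f_0 ≤ f_x` for `2x ≤ L`. -/
theorem choose_mul_le_of_chain {L : ℕ} {f : ℕ → ℚ}
    (hf : ∀ j, 2 * j + 2 ≤ L → ((L : ℚ) - j) * f j ≤ (j + 1) * f (j + 1)) (x : ℕ)
    (hx : 2 * x ≤ L) : (Nat.choose L x : ℚ) * f 0 ≤ f x := by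
  have := chain_choose_mul_le hf 0 x (by omega)
  simpa using this

/-- The chain between two levels below the middle: `y ≤ x`, `2x ≤ L` ⟹ `C(L, y)·(f_x − f_y) ≥ (C(L, x) − C(L, y))·f_y`. -/
theorem choose_mul_sub_le_of_chain {L : ℕ} {f : ℕ → ℚ}
    (hf : ∀ j, 2 * j + 2 ≤ L → ((L : ℚ) - j) * f j ≤ (j + 1) * f (j + 1)) {x y : ℕ} (hyx : y ≤ x)
    (hx : 2 * x ≤ L) : ((Nat.choose L x : ℚ) - Nat.choose L y) * f y ≤ (Nat.choose L y : ℚ) * (f x - f y) := by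
  obtain ⟨d, rfl⟩ := Nat.exists_eq_add_of_le hyx
  have := chain_choose_mul_le hf y d hx
  linarith

/-- `C(L, ·)` is non-decreasing up to the middle: `y ≤ x`, `2x ≤ L` ⟹ `C(L, y) ≤ C(L, x)`. -/
theorem choose_le_choose_of_le_half {L x y : ℕ} (hyx : y ≤ x) (hx : 2 * x ≤ L) :
    Nat.choose L y ≤ Nat.choose L x := by
  obtain ⟨d, rfl⟩ := Nat.exists_eq_add_of_le hyx
  have key : ∀ d : ℕ, 2 * (y + d) ≤ L → Nat.choose L y ≤ Nat.choose L (y + d) := by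
    intro d
    induction d with
    | zero => intro _; simp
    | succ d ih =>
      intro hd
      have h1 := ih (by omega)
      have h2 : Nat.choose L (y + d) ≤ Nat.choose L (y + d + 1) :=
        Nat.choose_le_succ_of_lt_half_left (by omega)
      rw [show y + (d + 1) = y + d + 1 by omega]
      exact h1.trans h2
  exact key d hx

/-- **THE MONOTONE-PAIR LEMMA (7.4)**: for a symmetric sequence `f` on `[0, L]` (`f_{L−x} = f_x`) with
Theorem A, and `y < x` with `x + y + 1 ≤ L`: `f_x − f_y ≥ (C(L, x) − C(L, y))·f_0`. -/
theorem monotone_pair_of_chain {L : ℕ} {f : ℕ → ℚ}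
    (hf : ∀ j, 2 * j + 2 ≤ L → ((L : ℚ) - j) * f j ≤ (j + 1) * f (j + 1))
    (hsymm : ∀ j, j ≤ L → f (L - j) = f j) {x y : ℕ} (hyx : y < x) (hxy : x + y + 1 ≤ L) :
    ((Nat.choose L x : ℚ) - Nat.choose L y) * f 0 ≤ f x - f y := by
  -- reflect both levels into the lower half
  have key : ∀ x' y' : ℕ, y' < x' → 2 * x' ≤ L →
      ((Nat.choose L x' : ℚ) - Nat.choose L y') * f 0 ≤ f x' - f y' := by
    intro x' y' hlt hx'
    have h1 := choose_mul_sub_le_of_chain hf (le_of_lt hlt) hx'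
    have h2 := choose_mul_le_of_chain hf y' (by omega)
    have hpos : (0 : ℚ) < Nat.choose L y' := by exact_mod_cast Nat.choose_pos (by omega)
    have hcc : (Nat.choose L y' : ℚ) ≤ Nat.choose L x' := by
      exact_mod_cast choose_le_choose_of_le_half (le_of_lt hlt) hx'
    have h3 : ((Nat.choose L x' : ℚ) - Nat.choose L y') * ((Nat.choose L y' : ℚ) * f 0) ≤
        ((Nat.choose L x' : ℚ) - Nat.choose L y') * f y' :=
      mul_le_mul_of_nonneg_left h2 (by linarith)
    have h4 : (Nat.choose L y' : ℚ) * (((Nat.choose L x' : ℚ) - Nat.choose L y') * f 0) ≤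
        (Nat.choose L y' : ℚ) * (f x' - f y') := by
      calc (Nat.choose L y' : ℚ) * (((Nat.choose L x' : ℚ) - Nat.choose L y') * f 0)
          = ((Nat.choose L x' : ℚ) - Nat.choose L y') * ((Nat.choose L y' : ℚ) * f 0) := by ring
        _ ≤ ((Nat.choose L x' : ℚ) - Nat.choose L y') * f y' := h3
        _ ≤ (Nat.choose L y' : ℚ) * (f x' - f y') := h1
    exact le_of_mul_le_mul_left h4 hpos
  by_cases hx : 2 * x ≤ L
  · exact key x y hyx hx
  · -- `x` is above the middle: use `f x = f (L − x)`, `C(L, x) = C(L, L − x)`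
    have hxL : x ≤ L := by omega
    have hs := hsymm x hxL
    have hc : Nat.choose L (L - x) = Nat.choose L x := Nat.choose_symm hxL
    have := key (L - x) y (by omega) (by omega)
    rw [hs, hc] at this
    exact this

end PercRepro.Cogirth
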